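import Summits.ResolutionOfSingularities.ResolutionOfSingularities.Theorems.HilbertSamuelEliminationSigmaMaxModificationsCorridor3SigmaSurfaceSncCarrier
import Summits.ResolutionOfSingularities.ResolutionOfSingularities.Theorems.HilbertSamuelEliminationSigmaMaxModificationsCorridor3SigmaSurfaceReadyOfSnc
import Literature.AlgebraicGeometry.Resolution.SncStrata
import Literature.AlgebraicGeometry.Resolution.ExceptionalPointsFinite
import Literature.AlgebraicGeometry.Resolution.GermsOfClosedSubsets
import Literature.AlgebraicGeometry.Resolution.PrimeDivisorIdeals
import HarnessLib

/-!
# [OURS · L1 W4.2] σ-LAYER PHASE B′ — `Corridor3SigmaSncCarrierOfSnc`: THE ENTRY LEMMA — an snc SET has an snc CARRIER (the reduced ideals of its irreducible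
# components form a list with simple normal crossings), so on a Noetherian regular surface `ℓ = 0` ALONE feeds the cure-point bookkeeping of p554169:
# every point step at a point of an snc configuration keeps `ℓ = 0`
# (res-L1-w42-stub-1 DESIGN CHECK 2 (b)/(c), 17:45Z; crux chain w42 `SigmaMaxModifications` stmt-ResolutionOfSingularities-18506 / conjunct
# `SigmaMaxModificationsCorridor3` stmt-ResolutionOfSingularities-19249; helper of res-L1-w42-stub-1 (gen 5), `--supports stmt-…-19249 --as helper`, counted 0)

HONEST FRAMING. OURS bookkeeping over Literature `maxPoints` / `maxPoints_finite` / `exists_mem_maxPoints_specializes` (`…MaximalPoints`, `…ExceptionalPointsFinite`,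
`…GermsOfClosedSubsets`), `primeDivisorIdeal` / `stalkIdeal_primeDivisorIdeal` (`…PrimeDivisorIdeals`), `primeOfSpecializes_mem_minimalPrimes_of_mem_maxPoints` /
`IsRsopPart.mem_minimalPrimes_span_prod_iff` / `specializes_of_primeOfSpecializes_le` (`…SncStrata`, Stacks 01J7), and this seat's `hasSNC_of_isStrictNormalCrossingsDivisor_divisorSet`
(p551893) and `HasSncCarrier` (p554169). NOTHING here is a statement of H. Hironaka's manuscript [Hironaka2017] nor of [CossartJannsenSaito2020]; no named fact. AI-written; AI
review is weaker than expert review.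

THE ARGUMENT. `S` snc on `D` (all local rings regular, `D` Noetherian): the carrier is the list of the reduced ideals `𝓘(cl{η})` of the (finitely many) maximal points
`η` of `S`. At `x ∈ cl{η}` the stalk is the prime `𝔭_η` of the generisation `η ⤳ x`, a MINIMAL prime over `𝓘(S)_x = (∏ zᵢ)` (η is maximal in `S`), hence `= (zᵢ)` for
one of the snc parameters — PRIME principal; distinct maximal points through `x` have distinct primes. So p551893 applies: the list has simple normal crossings, and
its divisor set `⋃ cl{η}` is `S`.

## Contents (namespace `…Theorems.SigmaMaxModificationsCorridor3.Sigma`)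

* `sncComponentList hS` (the carrier list), `mem_sncComponentList_iff`, `divisorSet_sncComponentList` (`= S`), `stalkIdeal_primeDivisorIdeal_eq_span_of_mem_maxPoints`
  (the stalk of a component ideal at a point of an snc set is generated by one of the snc parameters).
* **`hasSncCarrier_of_isStrictNormalCrossingsDivisor`** (`D` Noetherian with regular local rings, `S` snc ⇒ `HasSncCarrier S`) and `hasSncCarrier_iff`.
* RUN LEVEL **`surfaceSncLength_next_eq_zero_of_point`**: on an irreducible `D` with Noetherian regular reduced surface `D̃`, if `ℓ(E, D) = 0` (read as «`S(E, D)` is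
  snc»: `IsStrictNormalCrossingsDivisor D̃ S(E,D)`) and the step blows up the reduced point `ι_D q` with `q ∈ S(E, D)`, `{q} ≠ D̃`, then `ℓ(E.next C, D′) = 0` and
  `S(E.next C, D′)` is snc — the cure-POINT step of PHASE B′ keeps the first coordinate of `lex(ℓ, M)`.

VACUITY SELF-CHECK. The carrier is the honest component list (finitely many maximal points of a closed subset of a Noetherian scheme); hypotheses `IsNoetherian` and
`Scheme.IsRegular` of `D̃` are those of the (P1*) regular-surface phase.
-/

noncomputable section

set_option linter.dupNamespace false -- mandated namespace of this single-conjunct summit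

open CategoryTheory AlgebraicGeometry TopologicalSpace IsLocalRing
open Summit.ResolutionOfSingularities.ResolutionOfSingularities.Theorems.CampaignW42
open Literature.AlgebraicGeometry.Resolution Literature.RingTheory.HilbertSamuel

namespace Summit.ResolutionOfSingularities.ResolutionOfSingularities.Theorems.SigmaMaxModificationsCorridor3.Sigma

universe u

open Scheme.IdealSheafData

/-! ## The component list of an snc set -/

section Components

variable {D : Scheme.{u}} [AlgebraicGeometry.IsNoetherian D] {S : Set D}

/-- [OURS · L1 W4.2] **THE COMPONENT LIST of a closed subset** of a Noetherian scheme: the reduced ideals `𝓘(cl{η})` of its maximal points `η` (= generic points of its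
irreducible components), in some order. NOT a statement of the manuscript. [folklore] -/
def sncComponentList (hS : IsClosed S) : Boundary D :=
  ((maxPoints_finite hS).toFinset.toList).map fun η => primeDivisorIdeal η

/-- Membership in the component list. [folklore] -/
theorem mem_sncComponentList_iff (hS : IsClosed S) {Γ : D.IdealSheafData} :
    Γ ∈ sncComponentList hS ↔ ∃ η ∈ maxPoints S, primeDivisorIdeal η = Γ := by
  simp only [sncComponentList, List.mem_map, Finset.mem_toList, Set.Finite.mem_toFinset]

/-- **The component list carries exactly `S`**: `⋃_η cl{η} = S`. [folklore] -/
theorem divisorSet_sncComponentList (hS : IsClosed S) : (sncComponentList hS).divisorSet = S := by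
  ext x
  rw [Boundary.mem_divisorSet_iff]
  constructor
  · rintro ⟨Γ, hΓ, hx⟩
    obtain ⟨η, hη, rfl⟩ := (mem_sncComponentList_iff hS).mp hΓ
    rw [coe_support_primeDivisorIdeal] at hx
    exact hS.closure_subset_iff.mpr (Set.singleton_subset_iff.mpr (maxPoints_subset S hη)) hx
  · intro hx
    obtain ⟨η, hη, hηx⟩ := exists_mem_maxPoints_specializes hS hx
    exact ⟨primeDivisorIdeal η, (mem_sncComponentList_iff hS).mpr ⟨η, hη, rfl⟩, by rw [coe_support_primeDivisorIdeal]; exact hηx.mem_closure⟩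

omit [AlgebraicGeometry.IsNoetherian D] in
/-- **THE STALK OF A COMPONENT IDEAL AT A POINT OF AN SNC SET IS GENERATED BY ONE OF THE SNC PARAMETERS**: for `η` a maximal point of the snc set `S`, `η ⤳ x`, and
`z` an snc rsop part at `x` (`𝓘(S)_x = (∏ zᵢ)`), `𝓘(cl{η})_x = (zᵢ)` for some `i` (the prime of `η` is a minimal prime over `(∏ zᵢ)`). [folklore] -/
theorem stalkIdeal_primeDivisorIdeal_eq_span_of_mem_maxPoints (hSc : IsClosed S) {η x : D} (hη : η ∈ maxPoints S) (h : η ⤳ x) {r : ℕ}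
    {z : Fin r → D.presheaf.stalk x} (hz : IsRsopPart z) (hI : stalkIdeal (vanishingIdeal (⟨S, hSc⟩ : Closeds D)) x = Ideal.span {∏ i, z i}) :
    ∃ i, stalkIdeal (primeDivisorIdeal η) x = Ideal.span {z i} := by
  have hmin := primeOfSpecializes_mem_minimalPrimes_of_mem_maxPoints (Z := ⟨S, hSc⟩) hη h
  rw [hI, hz.mem_minimalPrimes_span_prod_iff] at hmin
  obtain ⟨i, hi⟩ := hmin
  exact ⟨i, by rw [stalkIdeal_primeDivisorIdeal h, hi]⟩

/-- **THE ENTRY LEMMA: AN SNC SET HAS AN SNC CARRIER** — on a Noetherian scheme all of whose local rings are regular, the component list of a strict normal crossings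
divisor `S` has simple normal crossings (Literature `HasSNC`) and divisor set `S`. [folklore] -/
theorem hasSncCarrier_of_isStrictNormalCrossingsDivisor (hreg : Scheme.IsRegular D) (hS : IsStrictNormalCrossingsDivisor D S) : HasSncCarrier S := by
  have hSc : IsClosed S := hS.isClosed
  refine ⟨sncComponentList hSc, ?_, divisorSet_sncComponentList hSc⟩
  have hcl : (⟨closure S, isClosed_closure⟩ : Closeds D) = ⟨S, hSc⟩ := Closeds.ext hSc.closure_eq
  refine hasSNC_of_isStrictNormalCrossingsDivisor_divisorSet hreg _ ?_ ?_ (by rw [divisorSet_sncComponentList]; exact hS)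
  · -- prime principal stalks
    intro Γ hΓ x hx
    obtain ⟨η, hη, rfl⟩ := (mem_sncComponentList_iff hSc).mp hΓ
    have h : η ⤳ x := (mem_support_primeDivisorIdeal_iff η x).mp hx
    have hxS : x ∈ S := hSc.closure_subset_iff.mpr (Set.singleton_subset_iff.mpr (maxPoints_subset S hη)) h.mem_closure
    obtain ⟨r, z, -, hz, hI⟩ := (isSNCIdeal_iff_exists_isRsopPart _).mp (hS.isStrictNormalCrossingsAt hxS)
    rw [hcl] at hI
    obtain ⟨i, hi⟩ := stalkIdeal_primeDivisorIdeal_eq_span_of_mem_maxPoints hSc hη h hz hI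
    exact ⟨z i, hz.prime i, hi⟩
  · -- distinct components have distinct stalks
    intro Γ hΓ Γ' hΓ' hne x hx hx'
    obtain ⟨η, hη, rfl⟩ := (mem_sncComponentList_iff hSc).mp hΓ
    obtain ⟨η', hη', rfl⟩ := (mem_sncComponentList_iff hSc).mp hΓ'
    have h : η ⤳ x := (mem_support_primeDivisorIdeal_iff η x).mp hx
    have h' : η' ⤳ x := (mem_support_primeDivisorIdeal_iff η' x).mp hx'
    intro heq
    rw [stalkIdeal_primeDivisorIdeal h, stalkIdeal_primeDivisorIdeal h'] at heq
    have h1 : η' ⤳ η := specializes_of_primeOfSpecializes_le h h' heq.ge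
    have h2 : η' = η := hη.2 η' (maxPoints_subset S hη') h1
    exact hne (by rw [h2])

/-- **snc carrier iff snc set** (Noetherian, regular local rings). [folklore] -/
theorem hasSncCarrier_iff (hreg : Scheme.IsRegular D) : HasSncCarrier S ↔ IsStrictNormalCrossingsDivisor D S :=
  ⟨HasSncCarrier.isStrictNormalCrossingsDivisor, hasSncCarrier_of_isStrictNormalCrossingsDivisor hreg⟩

end Components

/-! ## Run level: a point step at a point of an snc configuration keeps `ℓ = 0` -/

section Run

variable {W : Scheme.{u}} [IsLocallyNoetherian W] {E : Boundary W} {D : Closeds W}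

/-- **THE CURE-POINT STEP KEEPS THE FIRST COORDINATE OF `lex(ℓ, M)`.** On an irreducible `D` whose reduced surface `D̃` is Noetherian with regular local rings, if the
configuration `S(E, D)` is a strict normal crossings divisor (`ℓ(E, D) = 0` read through `surfaceSncLength_eq_zero_iff`) and the step blows up the reduced point `ι_D q`
with `q ∈ S(E, D)`, `{q} ≠ D̃`, then the next configuration is again snc and `ℓ(E.next C, surfaceNext (blowup.π C) C D) = 0`. [folklore] -/
theorem surfaceSncLength_next_eq_zero_of_point [AlgebraicGeometry.IsNoetherian (menuCentre D).subscheme] (hreg : Scheme.IsRegular (menuCentre D).subscheme)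
    (hDirr : IsIrreducible (D : Set W)) (hS : IsStrictNormalCrossingsDivisor (menuCentre D).subscheme (surfaceTraceSet E D))
    {q : ↥(menuCentre D).subscheme} (hq : IsClosed ({q} : Set ↥(menuCentre D).subscheme)) (hqW : IsClosed ({(menuCentre D).subschemeι.base q} : Set W))
    (hne : ({q} : Set ↥(menuCentre D).subscheme) ≠ Set.univ) (hqS : q ∈ surfaceTraceSet E D) {C : W.IdealSheafData}
    (hC : C = vanishingIdeal ⟨{(menuCentre D).subschemeι.base q}, hqW⟩) :
    IsStrictNormalCrossingsDivisor (menuCentre (surfaceNext (blowup.π C) C D)).subscheme (surfaceTraceSet (E.next C) (surfaceNext (blowup.π C) C D)) ∧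
      surfaceSncLength (E.next C) (surfaceNext (blowup.π C) C D) = 0 := by
  obtain ⟨hcar, hℓ⟩ := hasSncCarrier_next_of_point hDirr hq hqW hne hqS (hasSncCarrier_of_isStrictNormalCrossingsDivisor hreg hS) hC
  exact ⟨hcar.isStrictNormalCrossingsDivisor, hℓ⟩

end Run

end Summit.ResolutionOfSingularities.ResolutionOfSingularities.Theorems.SigmaMaxModificationsCorridor3.Sigma

end
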